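import Mathlib.Data.Real.Sign
import Summits.QuantumAdvantage.QuantumAdvantage.Theorems.CubicForrelationInPrBPP.Negative.SignedSlice

/-!
# `SignedCubicForrelationInPrBPP` — negative knowledge: the cubic partner of an exact pair is replaceable

Support file for crux `stmt-QuantumAdvantage-13933`
(`Summit.QuantumAdvantage.QuantumAdvantage.Theses.CubicForrelation.SignedCubicForrelationInPrBPP`, route
`QuantumAdvantage/CubicForrelation`), written by the standing disprover
refuter-cdisprove-stmt-QuantumAdvantage-13933-0 (2026-08-16); sequel to `Negative/SignedSlice.lean` of the
sibling crux `CubicForrelationInPrBPP`, whose rigidity lemma `W_eq_of_fsum_sq` (`S(f,g)² = 8ⁿ ⇒ W_g = (S/2ⁿ)·f`)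
is the only ingredient.

**The identity.** For an exact pair (`S(f,g)² = 8ⁿ`, i.e. `Φ(f,g) = ±1`) and EVERY real test function `g'`:

  `S(f,g) · ∑_x f(x) g'(x) = 2ⁿ · S(g',g)`        (`fsum_mul_cross_eq`; slots swapped: `fsum_mul_cross_eq'`),

over the tree's `forrelation`: `Φ(f,g) · ∑_x (-1)^{f(x)+g'(x)} = 2ⁿ · Φ(g',g)` (`forrelation_mul_cross_eq`), hence
`Φ(f,g) = sgn⟨f,g'⟩ · sgn Φ(g',g)` whenever `⟨f,g'⟩ ≠ 0` (`forrelation_eq_sign_cross_mul_sign`) and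
`|⟨f,g'⟩| = 2ⁿ|Φ(g',g)|` (`abs_cross_eq`). For `g' = 1` this is `SignedSlice.fsum_mul_bias_eq`.

**Why it is negative knowledge for the signed line.** The sign of an exact pair transports along ANY noticeable
correlation of the partner `f` with a test function: the signed problem for `(f,g)` reduces (randomised, by
sampling `⟨f,g'⟩ = ∑_x (-1)^{f+g'}` to `± 2ⁿ/poly`) to the signed problem for `(g',g)` for every `g'` with
`|Φ(g',g)| ≥ 1/poly`. With `g'` QUADRATIC, `W_{g'}` is a signed quadratic Gauss sum supported on a flat, so
`Φ(g',g)` is `2^{-k/2}` times the bias of a cubic over that flat and is samplable as well: every exact cubic pair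
in which either half has a quadratic approximant of constant correlation is decided classically in randomised
polynomial time once the approximant is known (and the algorithmic `U³` inverse theorem finds one). So classical
hardness of the sign — the thesis of route items `SignedCubicForrelationNotPrBPP` /
`SignedExactCubicForrelationNotPrBPP` — can only live on pairs BOTH of whose halves have second-order
nonlinearity `2^{n-1}(1 - o(1))`; and a proof of the crux `SignedCubicForrelationInPrBPP` may replace the
partner by any anchor it can correlate with it.

## References

* [AaronsonAmbainis2018] S. Aaronson, A. Ambainis, Forrelation, SIAM J. Comput. 47 (2018), §1.1.1.
* [ODonnell2014] R. O'Donnell, Analysis of Boolean Functions (2014), §1.4 (Parseval, inversion).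
* M. Tulsiani, J. Wolf, Quadratic Goldreich–Levin theorems, FOCS 2011 (arXiv:1105.4372) — orientation only
  (the algorithmic step is not formalised here).
-/

noncomputable section

namespace Summit.QuantumAdvantage.QuantumAdvantage.Theorems.SignedCubicForrelationInPrBPP.Negative

open Finset
open Literature.Computability.QuantumComplexity
open Literature.Computability.QuantumComplexity.BuzetChailloux (phi_signOf signOf_sq)
open Literature.Computability.QuantumComplexity.DerivativeWalsh
open Summit.QuantumAdvantage.QuantumAdvantage.Theorems.CubicForrelationInPrBPP.Negative (W_eq_of_fsum_sq)

variable {n : ℕ}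

/-- `S(f,g) = S(g,f)`. [folklore] -/
theorem fsum_comm (f g : (Fin n → Bool) → ℝ) : fsum f g = fsum g f := by
  rw [fsum_eq_sum_mul_W' f g, fsum_eq_sum_mul_W g f]

/-- **Cross-correlation identity.** For an exact pair (`S(f,g)² = 8ⁿ`, `f, g` `±1`-valued) and EVERY real
test function `g'`: `S(f,g) · ∑_x f(x) g'(x) = 2ⁿ · S(g',g)`. [folklore] -/
theorem fsum_mul_cross_eq (f g g' : (Fin n → Bool) → ℝ) (hf : ∀ x, f x ^ 2 = 1)
    (hg : ∀ y, g y ^ 2 = 1) (hS : fsum f g ^ 2 = (8 : ℝ) ^ n) :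
    fsum f g * ∑ x, f x * g' x = (2 : ℝ) ^ n * fsum g' g := by
  rw [fsum_eq_sum_mul_W g' g, mul_sum, mul_sum]
  refine sum_congr rfl fun x _ => ?_
  rw [W_eq_of_fsum_sq f g hf hg hS x]
  have h2 : (2 : ℝ) ^ n ≠ 0 := pow_ne_zero _ two_ne_zero
  field_simp

/-- The slots are symmetric: `S(f,g) · ∑_y g(y) f'(y) = 2ⁿ · S(f,f')` for every real `f'`. [folklore] -/
theorem fsum_mul_cross_eq' (f g f' : (Fin n → Bool) → ℝ) (hf : ∀ x, f x ^ 2 = 1)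
    (hg : ∀ y, g y ^ 2 = 1) (hS : fsum f g ^ 2 = (8 : ℝ) ^ n) :
    fsum f g * ∑ y, g y * f' y = (2 : ℝ) ^ n * fsum f f' := by
  have hS' : fsum g f ^ 2 = (8 : ℝ) ^ n := by rw [← fsum_comm f g]; exact hS
  have h := fsum_mul_cross_eq g f f' hg hf hS'
  rw [← fsum_comm f g, ← fsum_comm f f'] at h
  exact h

/-- The identity over the tree's `forrelation` for Boolean data: if `Φ(f,g)² = 1` then for every `g'`,
`Φ(f,g) · ∑_x (-1)^{f(x)+g'(x)} = 2ⁿ · Φ(g',g)`. [cite: AaronsonAmbainis2018, §1.1.1] -/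
theorem forrelation_mul_cross_eq (f g g' : (Fin n → Bool) → Bool) (hΦ : forrelation f g ^ 2 = 1) :
    forrelation f g * ∑ x, signOf (f x) * signOf (g' x) = (2 : ℝ) ^ n * forrelation g' g := by
  have hf : ∀ x, (fun x => signOf (f x)) x ^ 2 = 1 := fun x => signOf_sq (f x)
  have hg : ∀ y, (fun y => signOf (g y)) y ^ 2 = 1 := fun y => signOf_sq (g y)
  have key := two_pow_mul_forrelation_sq f g
  rw [hΦ, mul_one, sum_dwt_mul_dwt] at key
  have hS : fsum (fun x => signOf (f x)) (fun y => signOf (g y)) ^ 2 = (8 : ℝ) ^ n := by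
    rw [← key, pow_mul]; norm_num
  have hc := fsum_mul_cross_eq _ _ (fun x => signOf (g' x)) hf hg hS
  rw [← phi_signOf f g, ← phi_signOf g' g, phi_eq_fsum, phi_eq_fsum]
  calc (Real.sqrt ((2 : ℝ) ^ (3 * n)))⁻¹ * fsum (fun x => signOf (f x)) (fun y => signOf (g y)) *
        ∑ x, signOf (f x) * signOf (g' x)
      = (Real.sqrt ((2 : ℝ) ^ (3 * n)))⁻¹ * (fsum (fun x => signOf (f x)) (fun y => signOf (g y)) *
        ∑ x, signOf (f x) * signOf (g' x)) := by ring
    _ = (Real.sqrt ((2 : ℝ) ^ (3 * n)))⁻¹ *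
        ((2 : ℝ) ^ n * fsum (fun x => signOf (g' x)) (fun y => signOf (g y))) := by rw [hc]
    _ = _ := by ring

/-- **Sign transport.** On an exact pair the sign is the product of a samplable sign (`⟨f,g'⟩`) and the
sign of ANOTHER instance `(g',g)` with the same bent half: `Φ(f,g) = sgn(∑_x (-1)^{f(x)+g'(x)}) · sgn Φ(g',g)`
whenever the correlation is non-zero. [cite: AaronsonAmbainis2018, §1.1.1] -/
theorem forrelation_eq_sign_cross_mul_sign (f g g' : (Fin n → Bool) → Bool)
    (hΦ : forrelation f g ^ 2 = 1) (hc : ∑ x, signOf (f x) * signOf (g' x) ≠ 0) :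
    forrelation f g = Real.sign (∑ x, signOf (f x) * signOf (g' x)) * Real.sign (forrelation g' g) := by
  have h := forrelation_mul_cross_eq f g g' hΦ
  have h2 : (0 : ℝ) < 2 ^ n := by positivity
  have hΦ' : forrelation f g = 1 ∨ forrelation f g = -1 := by
    have hm : (forrelation f g - 1) * (forrelation f g + 1) = 0 := by ring_nf; linarith [hΦ]
    rcases mul_eq_zero.1 hm with h1 | h1
    · exact Or.inl (by linarith)
    · exact Or.inr (by linarith)
  rcases hΦ' with h1 | h1 <;> rw [h1] at h ⊢
  · rcases lt_or_gt_of_ne hc with hneg | hpos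
    · have : forrelation g' g < 0 := by nlinarith
      rw [Real.sign_of_neg hneg, Real.sign_of_neg this]; norm_num
    · have : 0 < forrelation g' g := by nlinarith
      rw [Real.sign_of_pos hpos, Real.sign_of_pos this]; norm_num
  · rcases lt_or_gt_of_ne hc with hneg | hpos
    · have : 0 < forrelation g' g := by nlinarith
      rw [Real.sign_of_neg hneg, Real.sign_of_pos this]; norm_num
    · have : forrelation g' g < 0 := by nlinarith
      rw [Real.sign_of_pos hpos, Real.sign_of_neg this]; norm_num

/-- The magnitudes agree: `|⟨f,g'⟩| = 2ⁿ |Φ(g',g)|`, so the transport is usable exactly when `g'` is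
noticeably forrelated with `g`. [cite: AaronsonAmbainis2018, §1.1.1] -/
theorem abs_cross_eq (f g g' : (Fin n → Bool) → Bool) (hΦ : forrelation f g ^ 2 = 1) :
    |∑ x, signOf (f x) * signOf (g' x)| = (2 : ℝ) ^ n * |forrelation g' g| := by
  have h := forrelation_mul_cross_eq f g g' hΦ
  have habs : |forrelation f g| = 1 := by
    have := congrArg Real.sqrt hΦ
    rwa [Real.sqrt_sq_eq_abs, Real.sqrt_one] at this
  have := congrArg (fun t : ℝ => |t|) h
  simp only [abs_mul, habs, one_mul, abs_pow, abs_two] at this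
  exact this

end Summit.QuantumAdvantage.QuantumAdvantage.Theorems.SignedCubicForrelationInPrBPP.Negative

end
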